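import Literature.NumberTheory.LFunctions.XiMultiplePositivityExpFactors
import Literature.Analysis.TotalPositivity.GenusZeroSectorSplitting
import Literature.Analysis.TotalPositivity.ExpPolyMultiplyPositive
import HarnessLib

/-!
# Katkova's Theorem 3 — proved: `Literature.NumberTheory.LFunctions.katkova_exp_cosh_pf_holds`

Trunk T-NT-LFUNC (Literature/NumberTheory/LFunctions). DISCHARGE of the named fact
`Literature.NumberTheory.LFunctions.katkova_exp_cosh_pf` (`XiMultiplePositivityExpFactors.lean`)
[Katkova2006, Thm. 3, arXiv p. 6]: "For every `m ∈ ℕ` there exists `n₀ ∈ ℕ` such that for all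
`n ≥ n₀`: (i) `e^{nz} ξ₁(z) ∈ PF_m`; (ii) `cosh(n√z) ξ₁(z) ∈ PF_m`" — in the tree's normalisation,
`conv (n^k/k!)ₖ (γ(k)/k!)ₖ` and `conv (n^{2k}/(2k)!)ₖ (γ(k)/k!)ₖ` are `m`-times positive.

## The proof

Katkova's printed proof (§§2–4: Pólya's composition formula for the consecutive Toeplitz
minors as `ν`-fold trigonometric integrals, a saddle-point analysis uniform in `0 < ε < 1` for
`e^z f¹(εz)` and `cosh √z · f¹(εz)`, and the Katkova–Ostrovskii Lemma 3) is replaced by the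
following argument, all of whose ingredients are theorems of the tree.

1. **Zero splitting** (`exists_sector_factorisation`, `GenusZeroSectorSplitting.lean`, from
   Hadamard's genus-`0` factorisation and Schoenberg's Theorem B): the zeros `w = (ρ - ½)²` of
   `ξ₁ = xiSq` in the open sector `|arg w| < πm/(m+1)` come from zeros `ρ` of `ζ` with
   `|Im ρ| ≤ (m+1)/π` (`abs_arg_sq_ge`), so they are bounded
   (`norm_le_of_xiSq_eq_zero_of_abs_arg_lt`); hence `ξ₁ = ξ₁(0) · Q · G` with `Q` a real
   polynomial, `Q(0) = 1`, collecting them, and `G` entire with real, `m`-times positive Taylor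
   sequence `(g_k)`. Since `ξ₁` has no zeros on `[0, ∞)` (`abs_arg_ge_of_xiSq_eq_zero` with RH up
   to height `16`), `Q > 0` on `[0, ∞)` (`eval_pos_of_xiSq_factor`).
2. **The polynomial factor** (`isMultiplyPositiveSeq_conv_exp_poly`,
   `isMultiplyPositiveSeq_conv_cosh_poly`, `ExpPolyMultiplyPositive.lean`): for `R ≥ R₀(m, Q)`
   the coefficient sequences of `e^{Rz} Q(z)` and `cosh(R√z) Q(z)` are `m`-times positive — the
   exact alternant formula for the solid Toeplitz minors of `e^w Q(w/R)`
   (`ExpPolySolidMinors.lean`), their positivity for `R` large uniformly in the row index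
   (`ExpPolySolidMinorsPos.lean`) and the solid-minor criterion (`SolidMinorCriterion.lean`,
   Katkova's Lemma 3).
3. **Assembly**: `PF_m` is closed under convolution and positive scaling, so the coefficient
   sequence `8 ξ₁(0) · conv (conv (R^k/k!) (q_k)) (g_k)` of `8 e^{Rz} ξ₁(z) = 8ξ₁(0) e^{Rz} Q G` is
   `m`-times positive; by uniqueness of Taylor coefficients (`hasSum_conv_exp_xi`,
   `taylorCoeff_eq_of_hasSum`) it IS `conv (R^k/k!)ₖ (γ(k)/k!)ₖ`. Likewise for `cosh`.
   Finally `n₀ := ⌈max R₀ R₀'⌉`.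

## References

* O. M. Katkova, *Multiple positivity and the Riemann zeta-function*, Comput. Methods Funct.
  Theory 7 (2007) 13–31; arXiv:math/0505174, Thm. 3 (p. 6), §2. [Katkova2006]
-/

noncomputable section

open Complex Filter Polynomial
open scoped Nat Topology

namespace Literature.NumberTheory.LFunctions

open Literature.Analysis.TotalPositivity

/-! ### The zeros of `ξ₁` in an open sector are bounded -/

/-- **Zeros of `ξ₁` in the open sector `|arg w| < πm/(m+1)` are bounded**: such a zero is
`w = z²` with `ζ(1/2 + z) = 0`, `|Re z| < 1/2`, and `|Im z| ≤ (m+1)/π` (otherwise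
`|arg w| ≥ π - π/(m+1)` by `abs_arg_sq_ge`), so `‖w‖ = ‖z‖² ≤ 1/4 + ((m+1)/π)²`.
[cite: Katkova2006, Thm. 1 (proof, (r1)) and Thm. 3] -/
theorem norm_le_of_xiSq_eq_zero_of_abs_arg_lt {m : ℕ} {w : ℂ} (hw : xiSq w = 0)
    (harg : |w.arg| < Real.pi * m / (m + 1)) :
    ‖w‖ ≤ 1 / 4 + (((m : ℝ) + 1) / Real.pi) ^ 2 := by
  obtain ⟨z, rfl, -, hre, hre', -⟩ := exists_zeta_zero_of_xiSq_eq_zero hw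
  set T : ℝ := ((m : ℝ) + 1) / Real.pi with hT
  have hTpos : 0 < T := by positivity
  have himT : |z.im| ≤ T := by
    by_contra hlt
    push Not at hlt
    have h := abs_arg_sq_ge hTpos (abs_le.2 ⟨by linarith, by linarith⟩) hlt
    have h1 : Real.pi - 1 / T = Real.pi * m / (m + 1) := by
      rw [hT]
      have hm : (0 : ℝ) < (m : ℝ) + 1 := by positivity
      field_simp
      ring
    linarith
  rw [norm_pow, Complex.sq_norm, Complex.normSq_apply]
  have h1 : z.re * z.re ≤ 1 / 4 := by nlinarith
  have h2 : z.im * z.im ≤ T ^ 2 := by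
    have := abs_le.1 himT
    nlinarith
  linarith

/-- **`ξ₁ = ξ₁(0) · Q · G`** with `Q` a real polynomial, `Q(0) = 1`, and `G` entire with real,
`m`-times positive Taylor sequence (`exists_sector_factorisation` for `ξ₁`: order `< 1`
(`isEntireOfOrderLtOne_xiSq`), real coefficients (`im_iteratedDeriv_xiSq`), `ξ₁(0) > 0`
(`xiSq_zero_re_pos`), bounded zeros in the open sector; Hadamard and Theorem B are the tree's
`hadamard_genus_zero_holds`, `schoenberg_sector_pf_holds`). [cite: Katkova2006, Thm. 3] -/
theorem xiSq_sector_factorisation (m : ℕ) :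
    ∃ (Q : ℝ[X]) (G : ℂ → ℂ), Q.eval 0 = 1 ∧ Differentiable ℂ G ∧
      (∀ n : ℕ, (iteratedDeriv n G 0).im = 0) ∧
      IsMultiplyPositiveSeq m (fun n => (iteratedDeriv n G 0).re / (n ! : ℝ)) ∧
      ∀ z : ℂ, xiSq z = xiSq 0 * (Q.map Complex.ofRealHom).eval z * G z :=
  exists_sector_factorisation Literature.Analysis.Complex.hadamard_genus_zero_holds
    schoenberg_sector_pf_holds isEntireOfOrderLtOne_xiSq im_iteratedDeriv_xiSq xiSq_zero_re_pos
    ⟨_, fun _ hz harg => norm_le_of_xiSq_eq_zero_of_abs_arg_lt (m := m) hz harg⟩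

/-- Evaluation of a real polynomial, mapped to `ℂ[X]`, at a real point. [folklore] -/
theorem eval_map_ofRealHom (Q : ℝ[X]) (x : ℝ) :
    (Q.map Complex.ofRealHom).eval (x : ℂ) = ((Q.eval x : ℝ) : ℂ) := by
  rw [Polynomial.eval_map, ← Complex.ofRealHom_eq_coe, Polynomial.eval₂_at_apply,
    Complex.ofRealHom_eq_coe]

/-- **The polynomial factor is positive on `[0, ∞)`**: `ξ₁` has no zeros there (its zeros have
`|arg w| ≥ π - 1/16`, `abs_arg_ge_of_xiSq_eq_zero` with `riemannHypothesisUpTo_sixteen`), so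
`Q ≠ 0` on `[0, ∞)`, and `Q(0) = 1 > 0` (intermediate value theorem). [folklore] -/
theorem eval_pos_of_xiSq_factor {Q : ℝ[X]} {G : ℂ → ℂ} (hQ0 : Q.eval 0 = 1)
    (hfact : ∀ z : ℂ, xiSq z = xiSq 0 * (Q.map Complex.ofRealHom).eval z * G z) :
    ∀ x : ℝ, 0 ≤ x → 0 < Q.eval x := by
  have hne : ∀ x : ℝ, 0 ≤ x → Q.eval x ≠ 0 := by
    intro x hx hQx
    have hz : xiSq x = 0 := by
      rw [hfact, eval_map_ofRealHom, hQx]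
      simp
    have h := abs_arg_ge_of_xiSq_eq_zero riemannHypothesisUpTo_sixteen (by norm_num) hz
    rw [Complex.arg_ofReal_of_nonneg hx, abs_zero] at h
    linarith [Real.pi_gt_three]
  intro x hx
  by_contra hle
  push Not at hle
  have hcont : ContinuousOn (fun y => Q.eval y) (Set.Icc 0 x) := Q.continuous.continuousOn
  have h0mem : (0 : ℝ) ∈ Set.Icc (Q.eval x) (Q.eval 0) := ⟨hle, by rw [hQ0]; exact zero_le_one⟩
  obtain ⟨y, hy, hy0⟩ := intermediate_value_Icc' hx hcont h0mem
  exact hne y hy.1 hy0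

/-! ### Generating functions of the three coefficient sequences -/

/-- The Taylor series of the entire function `G` with real coefficients `g_k = Re G⁽ᵏ⁾(0)/k!`.
[folklore] -/
theorem hasSum_taylor_of_real {G : ℂ → ℂ} (hGd : Differentiable ℂ G)
    (hGreal : ∀ n : ℕ, (iteratedDeriv n G 0).im = 0) (z : ℂ) :
    HasSum (fun n => (((iteratedDeriv n G 0).re / (n ! : ℝ) : ℝ) : ℂ) * z ^ n) (G z) := by
  have h := Complex.hasSum_taylorSeries_of_entire hGd 0 z
  have key : (fun n => (((iteratedDeriv n G 0).re / (n ! : ℝ) : ℝ) : ℂ) * z ^ n) =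
      fun n => (n ! : ℂ)⁻¹ • (z - 0) ^ n • iteratedDeriv n G 0 := by
    funext n
    have hd : iteratedDeriv n G 0 = (((iteratedDeriv n G 0).re : ℝ) : ℂ) := by
      apply Complex.ext
      · simp
      · simp [hGreal n]
    rw [smul_eq_mul, smul_eq_mul, sub_zero]
    conv_rhs => rw [hd]
    have hn : ((n ! : ℕ) : ℂ) ≠ 0 := by exact_mod_cast n.factorial_ne_zero
    push_cast
    field_simp
  rw [key]
  exact h

/-- The (finite) Taylor series of the polynomial factor. [folklore] -/
theorem hasSum_coeff_poly (Q : ℝ[X]) (z : ℂ) :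
    HasSum (fun n => ((Q.coeff n : ℝ) : ℂ) * z ^ n) ((Q.map Complex.ofRealHom).eval z) := by
  have hdeg : (Q.map Complex.ofRealHom).natDegree < Q.natDegree + 1 :=
    lt_of_le_of_lt Polynomial.natDegree_map_le (Nat.lt_succ_self _)
  rw [Polynomial.eval_eq_sum_range' hdeg]
  have h := hasSum_sum_of_ne_finset_zero (L := SummationFilter.unconditional ℕ)
    (f := fun n => ((Q.coeff n : ℝ) : ℂ) * z ^ n)
    (s := Finset.range (Q.natDegree + 1)) (fun n hn => by
      rw [Finset.mem_range, Nat.lt_succ_iff, not_le] at hn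
      rw [Polynomial.coeff_eq_zero_of_natDegree_lt hn]
      simp)
  have hs : ∑ i ∈ Finset.range (Q.natDegree + 1), (Q.map Complex.ofRealHom).coeff i * z ^ i =
      ∑ i ∈ Finset.range (Q.natDegree + 1), ((Q.coeff i : ℝ) : ℂ) * z ^ i :=
    Finset.sum_congr rfl fun i _ => by rw [Polynomial.coeff_map, Complex.ofRealHom_eq_coe]
  rw [hs]
  exact h

/-! ### Theorem 3 (i) and (ii) for real `R ≥ R₀(m)` -/

/-- **Theorem 3 (i) with a real parameter**: for every `m` there is `R₀` such that
`conv (R^k/k!)ₖ (γ(k)/k!)ₖ` — the coefficient sequence of `8 e^{Rz} ξ₁(z)` — is `m`-times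
positive for all `R ≥ R₀`. [cite: Katkova2006, Thm. 3 (i)] -/
theorem exists_isMultiplyPositiveSeq_conv_exp_xi (m : ℕ) : ∃ R₀ : ℝ, ∀ R : ℝ, R₀ ≤ R →
    IsMultiplyPositiveSeq m
      (conv (fun k => R ^ k / (k ! : ℝ)) (fun k => xiTaylorCoeff k / (k ! : ℝ))) := by
  obtain ⟨Q, G, hQ0, hGd, hGreal, hGpf, hfact⟩ := xiSq_sector_factorisation m
  have hQpos := eval_pos_of_xiSq_factor hQ0 hfact
  obtain ⟨R₀, hR₀⟩ := isMultiplyPositiveSeq_conv_exp_poly Q hQpos m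
  refine ⟨R₀, fun R hR => ?_⟩
  set g : ℕ → ℝ := fun n => (iteratedDeriv n G 0).re / (n ! : ℝ) with hg
  set q : ℕ → ℝ := fun k => Q.coeff k with hq
  set E : ℕ → ℝ := fun k => R ^ k / (k ! : ℝ) with hE
  set F0 : ℝ := (xiSq 0).re with hF0
  have hF0pos : 0 < F0 := xiSq_zero_re_pos
  have hPF : IsMultiplyPositiveSeq m (fun k => (8 * F0) * conv (conv E q) g k) :=
    ((hR₀ R hR).conv hGpf).smul (by positivity)
  -- generating functions
  have hGs : ∀ z : ℂ, HasSum (fun n => (g n : ℂ) * z ^ n) (G z) := hasSum_taylor_of_real hGd hGreal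
  have hqs : ∀ z : ℂ, HasSum (fun n => (q n : ℂ) * z ^ n) ((Q.map Complex.ofRealHom).eval z) :=
    hasSum_coeff_poly Q
  have hEs : ∀ z : ℂ, HasSum (fun n => (E n : ℂ) * z ^ n) (Complex.exp ((R : ℂ) * z)) :=
    hasSum_expSeq R
  have hEq : ∀ z : ℂ, HasSum (fun n => (conv E q n : ℂ) * z ^ n)
      (Complex.exp ((R : ℂ) * z) * (Q.map Complex.ofRealHom).eval z) := fun z =>
    hasSum_conv (hEs z) (hqs z) (summable_norm_of_hasSum_everywhere hEs z)
      (summable_norm_of_hasSum_everywhere hqs z)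
  have hEqG : ∀ z : ℂ, HasSum (fun n => (conv (conv E q) g n : ℂ) * z ^ n)
      (Complex.exp ((R : ℂ) * z) * (Q.map Complex.ofRealHom).eval z * G z) := fun z =>
    hasSum_conv (hEq z) (hGs z) (summable_norm_of_hasSum_everywhere hEq z)
      (summable_norm_of_hasSum_everywhere hGs z)
  -- `8 e^{Rz} ξ₁(z) = 8 ξ₁(0) · e^{Rz} Q(z) G(z)`
  have hxi0 : xiSq 0 = (F0 : ℂ) := by
    apply Complex.ext
    · simp [hF0]
    · have := im_iteratedDeriv_xiSq 0
      simpa using this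
  have h2 : ∀ z : ℂ, HasSum (fun n => (((8 * F0) * conv (conv E q) g n : ℝ) : ℂ) * z ^ n)
      (Complex.exp ((R : ℂ) * z) * (8 * xiSq z)) := by
    intro z
    have hident : Complex.exp ((R : ℂ) * z) * (8 * xiSq z) = ((8 * F0 : ℝ) : ℂ) *
        (Complex.exp ((R : ℂ) * z) * (Q.map Complex.ofRealHom).eval z * G z) := by
      rw [hfact z, hxi0]
      push_cast
      ring
    rw [hident]
    refine ((hEqG z).mul_left (((8 * F0 : ℝ)) : ℂ)).congr_fun fun n => ?_
    push_cast
    ring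
  -- uniqueness of Taylor coefficients
  have hcoef : ∀ k, conv E (fun k => xiTaylorCoeff k / (k ! : ℝ)) k =
      (8 * F0) * conv (conv E q) g k := by
    intro k
    have e1 := taylorCoeff_eq_of_hasSum one_pos (fun z _ => hasSum_conv_exp_xi R z) k
    have e2 := taylorCoeff_eq_of_hasSum one_pos (fun z _ => h2 z) k
    exact_mod_cast e1.symm.trans e2
  rw [show conv E (fun k => xiTaylorCoeff k / (k ! : ℝ)) =
    fun k => (8 * F0) * conv (conv E q) g k from funext hcoef]
  exact hPF

/-- **Theorem 3 (ii) with a real parameter**: for every `m` there is `R₀` such that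
`conv (R^{2k}/(2k)!)ₖ (γ(k)/k!)ₖ` — the coefficient sequence of `8 cosh(R√z) ξ₁(z)` — is `m`-times
positive for all `R ≥ R₀`. [cite: Katkova2006, Thm. 3 (ii)] -/
theorem exists_isMultiplyPositiveSeq_conv_cosh_xi (m : ℕ) : ∃ R₀ : ℝ, ∀ R : ℝ, R₀ ≤ R →
    IsMultiplyPositiveSeq m
      (conv (fun k => R ^ (2 * k) / ((2 * k) ! : ℝ)) (fun k => xiTaylorCoeff k / (k ! : ℝ))) := by
  obtain ⟨Q, G, hQ0, hGd, hGreal, hGpf, hfact⟩ := xiSq_sector_factorisation m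
  have hQpos := eval_pos_of_xiSq_factor hQ0 hfact
  obtain ⟨R₀, hR₀⟩ := isMultiplyPositiveSeq_conv_cosh_poly Q hQpos m
  refine ⟨R₀, fun R hR => ?_⟩
  set g : ℕ → ℝ := fun n => (iteratedDeriv n G 0).re / (n ! : ℝ) with hg
  set q : ℕ → ℝ := fun k => Q.coeff k with hq
  set Cs : ℕ → ℝ := fun k => R ^ (2 * k) / ((2 * k) ! : ℝ) with hCs
  set F0 : ℝ := (xiSq 0).re with hF0
  have hF0pos : 0 < F0 := xiSq_zero_re_pos
  have hPF : IsMultiplyPositiveSeq m (fun k => (8 * F0) * conv (conv Cs q) g k) :=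
    ((hR₀ R hR).conv hGpf).smul (by positivity)
  -- generating functions (`w = z^{1/2}`, `w² = z`)
  have hsq : ∀ z : ℂ, (z ^ (2⁻¹ : ℂ)) ^ 2 = z := fun z => by
    exact_mod_cast Complex.cpow_nat_inv_pow z two_ne_zero
  have hGs : ∀ z : ℂ, HasSum (fun n => (g n : ℂ) * z ^ n) (G z) := hasSum_taylor_of_real hGd hGreal
  have hqs : ∀ z : ℂ, HasSum (fun n => (q n : ℂ) * z ^ n) ((Q.map Complex.ofRealHom).eval z) :=
    hasSum_coeff_poly Q
  have hCss : ∀ z : ℂ, HasSum (fun n => (Cs n : ℂ) * z ^ n)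
      (Complex.cosh ((R : ℂ) * z ^ (2⁻¹ : ℂ))) := fun z => hasSum_coshSeq R (hsq z)
  have hCq : ∀ z : ℂ, HasSum (fun n => (conv Cs q n : ℂ) * z ^ n)
      (Complex.cosh ((R : ℂ) * z ^ (2⁻¹ : ℂ)) * (Q.map Complex.ofRealHom).eval z) := fun z =>
    hasSum_conv (hCss z) (hqs z) (summable_norm_of_hasSum_everywhere hCss z)
      (summable_norm_of_hasSum_everywhere hqs z)
  have hCqG : ∀ z : ℂ, HasSum (fun n => (conv (conv Cs q) g n : ℂ) * z ^ n)
      (Complex.cosh ((R : ℂ) * z ^ (2⁻¹ : ℂ)) * (Q.map Complex.ofRealHom).eval z * G z) :=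
    fun z => hasSum_conv (hCq z) (hGs z) (summable_norm_of_hasSum_everywhere hCq z)
      (summable_norm_of_hasSum_everywhere hGs z)
  have hxi0 : xiSq 0 = (F0 : ℂ) := by
    apply Complex.ext
    · simp [hF0]
    · have := im_iteratedDeriv_xiSq 0
      simpa using this
  have h2 : ∀ z : ℂ, HasSum (fun n => (((8 * F0) * conv (conv Cs q) g n : ℝ) : ℂ) * z ^ n)
      (Complex.cosh ((R : ℂ) * z ^ (2⁻¹ : ℂ)) * (8 * xiSq z)) := by
    intro z
    have hident : Complex.cosh ((R : ℂ) * z ^ (2⁻¹ : ℂ)) * (8 * xiSq z) = ((8 * F0 : ℝ) : ℂ) *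
        (Complex.cosh ((R : ℂ) * z ^ (2⁻¹ : ℂ)) * (Q.map Complex.ofRealHom).eval z * G z) := by
      rw [hfact z, hxi0]
      push_cast
      ring
    rw [hident]
    refine ((hCqG z).mul_left (((8 * F0 : ℝ)) : ℂ)).congr_fun fun n => ?_
    push_cast
    ring
  have hcoef : ∀ k, conv Cs (fun k => xiTaylorCoeff k / (k ! : ℝ)) k =
      (8 * F0) * conv (conv Cs q) g k := by
    intro k
    have e1 := taylorCoeff_eq_of_hasSum one_pos (fun z _ => hasSum_conv_cosh_xi R (hsq z)) k
    have e2 := taylorCoeff_eq_of_hasSum one_pos (fun z _ => h2 z) k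
    exact_mod_cast e1.symm.trans e2
  rw [show conv Cs (fun k => xiTaylorCoeff k / (k ! : ℝ)) =
    fun k => (8 * F0) * conv (conv Cs q) g k from funext hcoef]
  exact hPF

/-! ### Discharge -/

/-- **Katkova's Theorem 3, proved**: DISCHARGE of the named fact
`Literature.NumberTheory.LFunctions.katkova_exp_cosh_pf` [Katkova2006, Thm. 3] — for every `m`
there is `n₀` (namely `⌈max R₀ R₀'⌉`) such that for all `n ≥ n₀` both `e^{nz} ξ₁(z)` and
`cosh(n√z) ξ₁(z)` are in `PF_m` (their coefficient sequences `conv (n^k/k!) (γ(k)/k!)`,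
`conv (n^{2k}/(2k)!) (γ(k)/k!)` are `m`-times positive). [cite: Katkova2006, Thm. 3] -/
theorem katkova_exp_cosh_pf_holds : katkova_exp_cosh_pf := by
  intro m
  obtain ⟨R₁, hR₁⟩ := exists_isMultiplyPositiveSeq_conv_exp_xi m
  obtain ⟨R₂, hR₂⟩ := exists_isMultiplyPositiveSeq_conv_cosh_xi m
  refine ⟨⌈max R₁ R₂⌉₊, fun n hn => ⟨hR₁ n ?_, hR₂ n ?_⟩⟩
  · have h1 : max R₁ R₂ ≤ (n : ℝ) := le_trans (Nat.le_ceil _) (by exact_mod_cast hn)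
    exact le_trans (le_max_left _ _) h1
  · have h1 : max R₁ R₂ ≤ (n : ℝ) := le_trans (Nat.le_ceil _) (by exact_mod_cast hn)
    exact le_trans (le_max_right _ _) h1

end Literature.NumberTheory.LFunctions
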